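import Summits.AtomisticToContinuum.BoseEinsteinCondensation.Theorems.BECStronglyRayleighLatticeToPeriodicBridgeMuffinTinDefs
import Literature.MathematicalPhysics.QuantumManyBody.CondensateOccupationStability

/-!
# Route `BECStronglyRayleigh`, crux `LatticeToPeriodicBridge` (stmt-AtomisticToContinuum-9674),
# line `muffin-tin-reward-supermodularity` — stub S1b `stub_maxwellDanskin`

Stub file of the crux line `muffin-tin-reward-supermodularity` (skeleton
`Summits/AtomisticToContinuum/BoseEinsteinCondensation/Cruxes/LatticeToPeriodicBridge/Lines/muffin-tin-reward-supermodularity.lean`),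
landed `--supports stmt-AtomisticToContinuum-9674`: it proves the registered signature `Sig.stub_maxwellDanskin`
of the line's `Defs` module (`Theorems/BECStronglyRayleighLatticeToPeriodicBridgeMuffinTinDefs.lean`) BY NAME, in
the skeleton's namespace.

**Statement (S1b, Danskin ⇒ Maxwell).** At fixed `(v, N, L, M, w)` and `0 ≤ λ₁ ≤ λ₂`, write
`E(λ,κ) = twoCouplingEnergy v N L M w λ κ = ⨅_Ψ F(λ,κ)Ψ` with
`F(λ,κ)Ψ = E_v[Ψ] + λ⟨W⟩_Ψ + κ(N - n₀Ψ)`, and `n₀⁺(λ,κ) = upperCondensate v N L M w λ κ =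
⨅_{δ>0} ⨆ {n₀Ψ : F(λ,κ)Ψ ≤ E(λ,κ) + δ}`. If for every `ε > 0` there is `κ₀ > 0` with
`E(λ₂,0) + E(λ₁,κ) ≤ E(λ₂,κ) + E(λ₁,0) + εκ` for `0 ≤ κ ≤ κ₀` (the germ), then `n₀⁺(λ₂,0) ≤ n₀⁺(λ₁,0)`.

**Proof.** Two Danskin (envelope) inequalities in `ℝ≥0∞`, no uniqueness or gap hypothesis:
* *upper, at `λ₂`*: if `b < n₀⁺(λ₂,0)` then every window `δ > 0` contains a `δ`-near-minimiser `Ψ` of `F(λ₂,0,·)`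
  with `n₀Ψ > b`, used as a trial state at `κ > 0`: `E(λ₂,κ) ≤ E(λ₂,0) + κ(N - b)` (`MaxwellDanskin.upper_danskin`);
* *lower, at `λ₁`*: if `n₀⁺(λ₁,0) < a` then some window `η > 0` has `⨆ {n₀Φ : Φ η-near-min} ≤ a`, and splitting
  `⨅_Φ` into near-minimisers and the rest gives `E(λ₁,κ) ≥ E(λ₁,0) + min(η, κ(N - a))`
  (`MaxwellDanskin.lower_danskin`).
If `n₀⁺(λ₁,0) < a < b < n₀⁺(λ₂,0)` (reals exist since `n₀ ≤ N`), the germ at `ε = (b - a)/2` and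
`0 < κ ≤ min(κ₀, η/(N+1))` give, after cancelling the finite `E(λ₁,0) + E(λ₂,0)`, `κ(N - a) ≤ κ(N - b) + εκ`, i.e.
`b - a ≤ (b - a)/2`, absurd. Finiteness: `E(λ₁,0) < ⊤ ⇒ E(λ₂,0) < ⊤` (`⟨W⟩_Ψ ≤ 3N < ⊤`); and if `E(λ₁,0) = ⊤`
(e.g. no trial state, `L ≤ 0 < N`) every state is a near-minimiser at `λ₁`, so `n₀⁺(λ₁,0) = ⨆_Ψ n₀Ψ ≥ n₀⁺(λ₂,0)`.

References: Danskin 1967 / Topkis 1978 (envelope theorem — language only); LSSY2005 App. A (A.11) (`n₀ ≤ N`);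
Fournais2020 (1.1)–(1.5).
-/

noncomputable section

namespace Summit.AtomisticToContinuum.BoseEinsteinCondensation.Cruxes.LatticeToPeriodicBridge.MuffinTinRewardSupermodularity

open MeasureTheory Filter
open scoped ENNReal NNReal Topology
open Literature.MathematicalPhysics.QuantumManyBody.BoseGas
open Summit.AtomisticToContinuum.BoseEinsteinCondensation.Theses
open Summit.AtomisticToContinuum.BoseEinsteinCondensation.Theses.BECStronglyRayleigh

/-! ## Bookkeeping: trial states, `n₀ ≤ N`, the `κ`-slice of the functional -/

namespace MaxwellDanskin

variable {N : ℕ} {L : ℝ}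

/-- A periodic trial state only exists on a genuine torus (`0 < L`) or without particles (`N = 0`):
otherwise the cell `[0,L)^{3N}` is null and nothing is normalised on it. [folklore] -/
theorem side_pos_or_eq_zero (Ψ : PeriodicTrialState N L) : 0 < L ∨ N = 0 := by
  by_contra h
  push Not at h
  have hvol : volume (cellN N L) = 0 := by
    rw [volume_cellN, ENNReal.ofReal_of_nonpos h.1, zero_pow three_ne_zero, zero_pow h.2]
  have h1 := Ψ.norm_eq
  rw [setLIntegral_measure_zero _ _ hvol] at h1
  exact zero_ne_one h1

/-- `n₀Ψ ≤ N` for every periodic trial state (LSSY App. A (A.11) on a genuine torus; `0 ≤ 0` for `N = 0`).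
[folklore] -/
theorem condensateOccupation_le_card (Ψ : PeriodicTrialState N L) :
    condensateOccupation N L Ψ.ψ ≤ (N : ℝ≥0∞) := by
  rcases side_pos_or_eq_zero Ψ with hL | hN
  · calc condensateOccupation N L Ψ.ψ
        ≤ (N : ℝ≥0∞) * ∫⁻ X in cellN N L, (‖Ψ.ψ X‖₊ : ℝ≥0∞) ^ 2 :=
          condensateOccupation_le_card_mul_lintegral hL Ψ.contDiff.continuous
      _ = N := by rw [Ψ.norm_eq, mul_one]
  · subst hN
    simp [condensateOccupation, occupation]

/-- The upper condensate never exceeds the particle number. [folklore] -/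
theorem upperCondensate_le_card (v : ℝ → ℝ≥0∞) (N : ℕ) (L : ℝ) (M : ℕ) (w lam kap : ℝ) :
    upperCondensate v N L M w lam kap ≤ (N : ℝ≥0∞) := by
  unfold upperCondensate
  exact (iInf₂_le (1 : ℝ≥0∞) one_pos).trans (iSup₂_le fun Ψ _ => condensateOccupation_le_card Ψ)

/-- The `κ`-slice of the two-coupling functional: `F(λ,κ)Ψ = F(λ,0)Ψ + κ(N - n₀Ψ)`. [folklore] -/
theorem twoCouplingFunctional_eq_add (v : ℝ → ℝ≥0∞) (M : ℕ) (w lam kap : ℝ) (Ψ : PeriodicTrialState N L) :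
    twoCouplingFunctional v M w lam kap Ψ =
      twoCouplingFunctional v M w lam 0 Ψ +
        ENNReal.ofReal kap * ((N : ℝ≥0∞) - condensateOccupation N L Ψ.ψ) := by
  rw [twoCouplingFunctional_kap_zero]
  rfl

/-- Finiteness transfer in `λ`: if `E(λ₁,0) < ⊤` then `E(λ₂,0) < ⊤` for every `λ₂` (a state of finite
`F(λ₁,0)` has finite periodic energy, and `λ₂⟨W⟩ ≤ 3λ₂N < ⊤`). [folklore] -/
theorem twoCouplingEnergy_ne_top_of_ne_top (v : ℝ → ℝ≥0∞) (N : ℕ) (L : ℝ) (M : ℕ) (w lam₁ lam₂ : ℝ)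
    (h : twoCouplingEnergy v N L M w lam₁ 0 ≠ ⊤) : twoCouplingEnergy v N L M w lam₂ 0 ≠ ⊤ := by
  obtain ⟨Ψ, hΨ⟩ := iInf_lt_iff.1 h.lt_top
  have hpE : periodicEnergy v Ψ < ⊤ := by
    rw [twoCouplingFunctional_kap_zero] at hΨ
    exact le_self_add.trans_lt hΨ
  refine ne_top_of_le_ne_top ?_ (iInf_le _ Ψ)
  rw [twoCouplingFunctional_kap_zero]
  exact ENNReal.add_ne_top.2
    ⟨hpE.ne, ENNReal.mul_ne_top ENNReal.ofReal_ne_top (wallEnergy_lt_top M w Ψ).ne⟩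

/-- The junk case: if `E(λ₁,0) = ⊤` every state is a near-minimiser at `λ₁`, so `n₀⁺(λ₁,0) = ⨆_Ψ n₀Ψ` dominates
every upper condensate. [folklore] -/
theorem upperCondensate_le_of_eq_top (v : ℝ → ℝ≥0∞) (N : ℕ) (L : ℝ) (M : ℕ) (w lam₁ lam₂ kap : ℝ)
    (h : twoCouplingEnergy v N L M w lam₁ 0 = ⊤) :
    upperCondensate v N L M w lam₂ kap ≤ upperCondensate v N L M w lam₁ 0 := by
  unfold upperCondensate
  refine le_iInf₂ fun δ hδ => (iInf₂_le δ hδ).trans (iSup₂_le fun Ψ _ => ?_)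
  refine le_iSup₂_of_le (f := fun (Ψ : PeriodicTrialState N L)
    (_ : twoCouplingFunctional v M w lam₁ 0 Ψ ≤ twoCouplingEnergy v N L M w lam₁ 0 + δ) =>
      condensateOccupation N L Ψ.ψ) Ψ ?_ le_rfl
  rw [h, top_add]
  exact le_top

/-! ## The two Danskin inequalities -/

/-- **Upper Danskin inequality** (at `λ₂`): if `b < n₀⁺(λ,0)` (`0 ≤ b`), then every window `δ > 0` contains a
`δ`-near-minimiser of `F(λ,0,·)` with `n₀ > b`; as a trial state at `κ` it gives
`E(λ,κ) ≤ E(λ,0) + κ(N - b)`. [folklore] -/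
theorem upper_danskin (v : ℝ → ℝ≥0∞) (N : ℕ) (L : ℝ) (M : ℕ) (w lam : ℝ) {b : ℝ} (hb0 : 0 ≤ b)
    (hb : ENNReal.ofReal b < upperCondensate v N L M w lam 0) {kap : ℝ} (hkap : 0 ≤ kap) :
    twoCouplingEnergy v N L M w lam kap ≤
      twoCouplingEnergy v N L M w lam 0 + ENNReal.ofReal (kap * (N - b)) := by
  refine ENNReal.le_of_forall_pos_le_add fun δ hδ _ => ?_
  have hδ' : (0 : ℝ≥0∞) < δ := ENNReal.coe_pos.2 hδ
  unfold upperCondensate at hb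
  have h1 : ENNReal.ofReal b < ⨆ (Ψ : PeriodicTrialState N L)
      (_ : twoCouplingFunctional v M w lam 0 Ψ ≤ twoCouplingEnergy v N L M w lam 0 + δ),
      condensateOccupation N L Ψ.ψ :=
    hb.trans_le (iInf₂_le (δ : ℝ≥0∞) hδ')
  rw [lt_iSup_iff] at h1
  obtain ⟨Ψ, hΨ⟩ := h1
  rw [lt_iSup_iff] at hΨ
  obtain ⟨hnear, hbΨ⟩ := hΨ
  calc twoCouplingEnergy v N L M w lam kap
      ≤ twoCouplingFunctional v M w lam kap Ψ := iInf_le _ Ψ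
    _ = twoCouplingFunctional v M w lam 0 Ψ +
          ENNReal.ofReal kap * ((N : ℝ≥0∞) - condensateOccupation N L Ψ.ψ) :=
        twoCouplingFunctional_eq_add v M w lam kap Ψ
    _ ≤ (twoCouplingEnergy v N L M w lam 0 + δ) +
          ENNReal.ofReal kap * ((N : ℝ≥0∞) - ENNReal.ofReal b) := by
        gcongr
    _ = twoCouplingEnergy v N L M w lam 0 + ENNReal.ofReal (kap * (N - b)) + δ := by
        rw [ENNReal.ofReal_mul hkap, ENNReal.ofReal_sub _ hb0, ENNReal.ofReal_natCast, add_right_comm]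

/-- **Lower Danskin inequality** (at `λ₁`): if at some window `η` all `η`-near-minimisers of `F(λ,0,·)` have
`n₀ ≤ a` (`0 ≤ a`), then `E(λ,κ) ≥ E(λ,0) + min(η, κ(N - a))` for `κ ≥ 0` (split `⨅_Φ` into near-minimisers,
which pay `κ(N - a)`, and the rest, which pay `η`). [folklore] -/
theorem lower_danskin (v : ℝ → ℝ≥0∞) (N : ℕ) (L : ℝ) (M : ℕ) (w lam : ℝ) {a : ℝ} (ha0 : 0 ≤ a) {η : ℝ≥0∞}
    (hs : ⨆ (Φ : PeriodicTrialState N L)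
      (_ : twoCouplingFunctional v M w lam 0 Φ ≤ twoCouplingEnergy v N L M w lam 0 + η),
      condensateOccupation N L Φ.ψ ≤ ENNReal.ofReal a) {kap : ℝ} (hkap : 0 ≤ kap) :
    twoCouplingEnergy v N L M w lam 0 + min η (ENNReal.ofReal (kap * (N - a))) ≤
      twoCouplingEnergy v N L M w lam kap := by
  refine le_iInf fun Φ => ?_
  rw [twoCouplingFunctional_eq_add v M w lam kap]
  by_cases hΦ : twoCouplingFunctional v M w lam 0 Φ ≤ twoCouplingEnergy v N L M w lam 0 + η
  · have hn : condensateOccupation N L Φ.ψ ≤ ENNReal.ofReal a :=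
      (le_iSup₂_of_le (f := fun (Φ : PeriodicTrialState N L)
        (_ : twoCouplingFunctional v M w lam 0 Φ ≤ twoCouplingEnergy v N L M w lam 0 + η) =>
          condensateOccupation N L Φ.ψ) Φ hΦ le_rfl).trans hs
    calc twoCouplingEnergy v N L M w lam 0 + min η (ENNReal.ofReal (kap * (N - a)))
        ≤ twoCouplingEnergy v N L M w lam 0 + ENNReal.ofReal (kap * (N - a)) := by
          gcongr
          exact min_le_right _ _
      _ ≤ twoCouplingFunctional v M w lam 0 Φ +
            ENNReal.ofReal kap * ((N : ℝ≥0∞) - condensateOccupation N L Φ.ψ) := by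
          rw [ENNReal.ofReal_mul hkap, ENNReal.ofReal_sub _ ha0, ENNReal.ofReal_natCast]
          exact add_le_add (iInf_le _ Φ) (mul_le_mul_right (tsub_le_tsub_left hn _) _)
  · push Not at hΦ
    calc twoCouplingEnergy v N L M w lam 0 + min η (ENNReal.ofReal (kap * (N - a)))
        ≤ twoCouplingEnergy v N L M w lam 0 + η := by
          gcongr
          exact min_le_left _ _
      _ ≤ twoCouplingFunctional v M w lam 0 Φ := hΦ.le
      _ ≤ _ := le_self_add

/-- The lower Danskin window: `n₀⁺(λ,0) < a` yields a finite window `η > 0` at which all `η`-near-minimisers of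
`F(λ,0,·)` have `n₀ ≤ a`. [folklore] -/
theorem exists_window_of_upperCondensate_lt (v : ℝ → ℝ≥0∞) (N : ℕ) (L : ℝ) (M : ℕ) (w lam : ℝ) {a : ℝ≥0∞}
    (ha : upperCondensate v N L M w lam 0 < a) :
    ∃ η : ℝ≥0∞, 0 < η ∧ η ≠ ⊤ ∧
      ⨆ (Φ : PeriodicTrialState N L)
        (_ : twoCouplingFunctional v M w lam 0 Φ ≤ twoCouplingEnergy v N L M w lam 0 + η),
        condensateOccupation N L Φ.ψ ≤ a := by
  unfold upperCondensate at ha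
  rw [iInf_lt_iff] at ha
  obtain ⟨η, hη⟩ := ha
  rw [iInf_lt_iff] at hη
  obtain ⟨hη0, hs⟩ := hη
  refine ⟨min η 1, lt_min hη0 one_pos, ne_top_of_le_ne_top ENNReal.one_ne_top (min_le_right _ _), ?_⟩
  refine le_trans ?_ hs.le
  exact biSup_mono fun Φ h => h.trans (add_le_add le_rfl (min_le_left _ _))

/-- The real-number punchline: `κ(N - a) ≤ κ(N - b) + (b - a)/2 · κ` is impossible for `κ > 0`, `a < b`. [folklore] -/
theorem not_le_of_gap {κ a b n : ℝ} (hκ : 0 < κ) (hab : a < b) :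
    ¬ κ * (n - a) ≤ κ * (n - b) + (b - a) / 2 * κ := by
  intro h
  nlinarith

end MaxwellDanskin

open MaxwellDanskin in
/-- **S1b — Danskin ⇒ Maxwell** (stub `stub_maxwellDanskin` of line `muffin-tin-reward-supermodularity`, crux
stmt-AtomisticToContinuum-9674): at fixed `(v, N, L, M, w)` and `0 ≤ λ₁ ≤ λ₂`, the `κ = 0⁺` germ of
supermodularity of `E(λ,κ)` with `o(κ)` slack implies `n₀⁺(λ₂,0) ≤ n₀⁺(λ₁,0)`: `N - n₀⁺(λ,0)` is the right
derivative `∂⁺_κ E(λ,0)` of the concave `κ ↦ E(λ,κ)` (upper and lower Danskin inequalities), and the germ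
compares the two right derivatives. [folklore] -/
theorem stub_maxwellDanskin : Sig.stub_maxwellDanskin := by
  intro v N L M w lam₁ lam₂ _hlam₁ _hlam hG
  by_cases hE₁ : twoCouplingEnergy v N L M w lam₁ 0 = ⊤
  · exact upperCondensate_le_of_eq_top v N L M w lam₁ lam₂ 0 hE₁
  have hE₂ : twoCouplingEnergy v N L M w lam₂ 0 ≠ ⊤ :=
    twoCouplingEnergy_ne_top_of_ne_top v N L M w lam₁ lam₂ hE₁
  by_contra hlt
  push Not at hlt
  -- reals `n₀⁺(λ₁,0) < a < b < n₀⁺(λ₂,0) ≤ N`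
  obtain ⟨a, ha0, h1a, ha2⟩ := ENNReal.lt_iff_exists_real_btwn.1 hlt
  obtain ⟨b, hb0, hab, hb2⟩ := ENNReal.lt_iff_exists_real_btwn.1 ha2
  have hab' : a < b := ((ENNReal.ofReal_lt_ofReal_iff_of_nonneg ha0).1 hab)
  have hbN : b ≤ N := by
    have h := hb2.trans_le (upperCondensate_le_card v N L M w lam₂ 0)
    rw [← ENNReal.ofReal_natCast, ENNReal.ofReal_lt_ofReal_iff_of_nonneg hb0] at h
    exact h.le
  -- the lower window at `λ₁`
  obtain ⟨η, hη0, hηtop, hs⟩ := exists_window_of_upperCondensate_lt v N L M w lam₁ h1a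
  have hηr : 0 < η.toReal := ENNReal.toReal_pos hη0.ne' hηtop
  -- the germ at `ε = (b - a)/2`, and the coupling `κ`
  obtain ⟨κ₀, hκ₀, hgerm⟩ := hG ((b - a) / 2) (by linarith)
  set κ : ℝ := min κ₀ (η.toReal / (N + 1))
  have hκpos : 0 < κ := lt_min hκ₀ (div_pos hηr (by positivity))
  have hκη : ENNReal.ofReal (κ * (N - a)) ≤ η := by
    rw [← ENNReal.ofReal_toReal hηtop]
    apply ENNReal.ofReal_le_ofReal
    calc κ * (N - a) ≤ η.toReal / (N + 1) * (N + 1) :=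
          mul_le_mul (min_le_right _ _) (by linarith) (by linarith) (by positivity)
      _ = η.toReal := div_mul_cancel₀ _ (by positivity)
  have hup := upper_danskin v N L M w lam₂ hb0 hb2 hκpos.le
  have hlow := lower_danskin v N L M w lam₁ ha0 hs hκpos.le
  rw [min_eq_right hκη] at hlow
  -- combine with the germ and cancel the finite energies
  have key : twoCouplingEnergy v N L M w lam₂ 0 + twoCouplingEnergy v N L M w lam₁ 0 +
      ENNReal.ofReal (κ * (N - a)) ≤
      twoCouplingEnergy v N L M w lam₂ 0 + twoCouplingEnergy v N L M w lam₁ 0 +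
        (ENNReal.ofReal (κ * (N - b)) + ENNReal.ofReal ((b - a) / 2 * κ)) :=
    calc twoCouplingEnergy v N L M w lam₂ 0 + twoCouplingEnergy v N L M w lam₁ 0 +
          ENNReal.ofReal (κ * (N - a))
        = twoCouplingEnergy v N L M w lam₂ 0 +
            (twoCouplingEnergy v N L M w lam₁ 0 + ENNReal.ofReal (κ * (N - a))) := add_assoc _ _ _
      _ ≤ twoCouplingEnergy v N L M w lam₂ 0 + twoCouplingEnergy v N L M w lam₁ κ := by gcongr
      _ ≤ twoCouplingEnergy v N L M w lam₂ κ + twoCouplingEnergy v N L M w lam₁ 0 +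
            ENNReal.ofReal ((b - a) / 2 * κ) := hgerm κ hκpos.le (min_le_left _ _)
      _ ≤ twoCouplingEnergy v N L M w lam₂ 0 + ENNReal.ofReal (κ * (N - b)) +
            twoCouplingEnergy v N L M w lam₁ 0 + ENNReal.ofReal ((b - a) / 2 * κ) := by gcongr
      _ = _ := by ring
  rw [ENNReal.add_le_add_iff_left (ENNReal.add_ne_top.2 ⟨hE₂, hE₁⟩),
    ← ENNReal.ofReal_add (mul_nonneg hκpos.le (by linarith)) (by nlinarith),
    ENNReal.ofReal_le_ofReal_iff (by nlinarith)] at key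
  exact not_le_of_gap hκpos hab' key

end Summit.AtomisticToContinuum.BoseEinsteinCondensation.Cruxes.LatticeToPeriodicBridge.MuffinTinRewardSupermodularity

end
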